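import Literature.Probability.Percolation.SelfRefinementMeasure
import Literature.Probability.Percolation.KohlerSchindlerTassionRSW
import Summits.CriticalPhenomena.CardyFormulaZ2.Theorems.CardySelfRefinementCriticalPathRSWStubCone3SmallA

/-!
# Stub `stub_cone3` of line `finite-size-envelope` (crux `CriticalPathRSW`), part 16:
small interior density (`c ≤ 1/10`) II — absorption of the two-sided event

Support file for item `stmt-CriticalPhenomena-10267` (stub `stub_cone3`).  For the tuple `(b, d)`
in the box with interior vertices off the two sides and `u` off the right side, and for interior
density `c ≤ 1/10`, the pattern sums satisfy (`Cone3.sum_patterns_le_smallC`)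

`Σ_{pat} P(Z⟪T, T(pat)⟫ \ Z⟪T, ∅⟫) ≤ Σ_{pat} P(Z⟪T, T⟫ \ Z⟪T, T(pat)⟫) + 6656 · Σ_{g ∈ Π} P(g pivotal)`.

Off the two-sided event `C₂` every term is charged to chain events (part 15).  On `C₂` we
condition on the cylinder "the four labels of `F` are closed" (probability `q ≥ (1 - c)^4 ≥ 4/7`,
independent of `C₂`): there no proper sub-pattern crosses, so the left sum only keeps the full
pattern while the right sum gains all seven proper patterns, and `q + 8 (1 - q) ≤ 7 q`.

References: Aizenman–Grimmett 1991 §3; Grimmett 1999 §2.4.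
-/

noncomputable section

namespace Summit.CriticalPhenomena.CardyFormulaZ2.Cruxes.CriticalPathRSW.FiniteSizeEnvelope

open Set MeasureTheory
open Literature.Probability.LatticeModels Literature.Probability.Percolation

namespace Cone3

variable {n : ℕ} {ρ c : ℝ} {b : Site 2} {d d' : Fin 2}

set_option quotPrecheck false

/-- The local frame of the tuple `(b, d)`: `pt⟪α, β⟫ = 3b + α e_d + β e_{d'}`. -/
local notation "pt⟪" α ", " β "⟫" =>
  ((3 : ℤ) • b + (α : ℤ) • (Pi.single d (1 : ℤ) : Site 2) + (β : ℤ) • (Pi.single d' (1 : ℤ) : Site 2))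

/-- The open labels of a coin configuration. -/
local notation "Op⟪" S "⟫" => {e : Site 2 × Fin 2 | RefinementOpen 3 S e}

/-- Crossing of the box by a label configuration. -/
local notation "Cr⟪" V "⟫" => (edgeConfig V ∈ KST2023.crossing (3 * n) (3 * (3 * n)))

/-- The override event: close `C`, open `A`, and ask for a left-right crossing of the box. -/
local notation "Z⟪" C ", " A "⟫" =>
  {S : Set (Site 2 × Fin 2 × Fin 3) |
    edgeConfig ((Op⟪S⟫ \ C) ∪ A) ∈ KST2023.crossing (3 * n) (3 * (3 * n))}

/-- The three sub-edges of the tuple. -/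
local notation "Tl" =>
  ({(pt⟪0, 0⟫, d), (pt⟪1, 0⟫, d), (pt⟪2, 0⟫, d)} : Set (Site 2 × Fin 2))

/-- The box. -/
local notation "Bx" => (KST2023.box (3 * n) (3 * (3 * n)))

/-- Its left side. -/
local notation "Lx" => {x : Site 2 | x ∈ KST2023.box (3 * n) (3 * (3 * n)) ∧ x 0 = -((3 * n : ℕ) : ℤ)}

/-- Its right side. -/
local notation "Rx" => {x : Site 2 | x ∈ KST2023.box (3 * n) (3 * (3 * n)) ∧ x 0 = ((3 * n : ℕ) : ℤ)}

/-- The four interior labels at the interior vertices of the tuple. -/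
local notation "Fl" =>
  ({(pt⟪1, 0⟫, d'), (pt⟪1, -1⟫, d'), (pt⟪2, 0⟫, d'), (pt⟪2, -1⟫, d')} : Set (Site 2 × Fin 2))

/-- The same four labels, as a `Finset`. -/
local notation "Flf" =>
  ({(pt⟪1, 0⟫, d'), (pt⟪1, -1⟫, d'), (pt⟪2, 0⟫, d'), (pt⟪2, -1⟫, d')} : Finset (Site 2 × Fin 2))

/-- Their four own coins. -/
local notation "Fc" =>
  ({(pt⟪1, 0⟫, d', (0 : Fin 3)), (pt⟪1, -1⟫, d', (0 : Fin 3)), (pt⟪2, 0⟫, d', (0 : Fin 3)),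
    (pt⟪2, -1⟫, d', (0 : Fin 3))} : Finset (Site 2 × Fin 2 × Fin 3))

/-- Pivotality of the own coin of the interior label `g`. -/
local notation "Piv⟪" g "⟫" =>
  ({S : Set (Site 2 × Fin 2 × Fin 3) |
      edgeConfig ((Op⟪S⟫ \ {g}) ∪ {g}) ∈ KST2023.crossing (3 * n) (3 * (3 * n))} \
    {S : Set (Site 2 × Fin 2 × Fin 3) |
      edgeConfig ((Op⟪S⟫ \ {g}) ∪ ∅) ∈ KST2023.crossing (3 * n) (3 * (3 * n))})

/-- The chain event of `(S₁, f)`: `S₁ ∪ {f}` closed, tuple open, `f` pivotal. -/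
local notation "Ech⟪" S₁ ", " f "⟫" => (Z⟪{f} ∪ ↑S₁, {f} ∪ Tl⟫ \ Z⟪{f} ∪ ↑S₁, ∅ ∪ Tl⟫)

/-- The two-sided event: with `F` closed the whole tuple is pivotal. -/
local notation "C2" => (Z⟪Tl ∪ Fl, Tl⟫ \ Z⟪Tl ∪ Fl, (∅ : Set (Site 2 × Fin 2))⟫)

/-- The eighteen interior labels next to the tuple used by the walks. -/
local notation "Πf" =>
  ({(pt⟪0, 1⟫, d), (pt⟪1, 0⟫, d'), (pt⟪-1, 0⟫, d'), (pt⟪-1, 1⟫, d), (pt⟪2, 1⟫, d), (pt⟪2, 0⟫, d'),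
    (pt⟪4, 0⟫, d'), (pt⟪3, 1⟫, d), (pt⟪1, 1⟫, d),
    (pt⟪0, -1⟫, d), (pt⟪1, -1⟫, d'), (pt⟪-1, -1⟫, d'), (pt⟪-1, -1⟫, d), (pt⟪2, -1⟫, d), (pt⟪2, -1⟫, d'),
    (pt⟪4, -1⟫, d'), (pt⟪3, -1⟫, d), (pt⟪1, -1⟫, d)} : Finset (Site 2 × Fin 2))

/-- The coin law. -/
local notation "P" => (prodBernoulli (refinementParam 3 ρ c))


/-- The sub-edges whose own coin lies in `X`. -/
local notation "Tof⟪" X "⟫" =>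
  {e : Site 2 × Fin 2 | (e = (pt⟪0, 0⟫, d) ∧ (pt⟪0, 0⟫, d, (0 : Fin 3)) ∈ X) ∨
    (e = (pt⟪1, 0⟫, d) ∧ (pt⟪1, 0⟫, d, (0 : Fin 3)) ∈ X) ∨ (e = (pt⟪2, 0⟫, d) ∧ (pt⟪2, 0⟫, d, (0 : Fin 3)) ∈ X)}

/-- The three own coins, as a `Finset`. -/
local notation "F₃" =>
  ({(pt⟪0, 0⟫, d, (0 : Fin 3)), (pt⟪1, 0⟫, d, (0 : Fin 3)), (pt⟪2, 0⟫, d, (0 : Fin 3))} :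
    Finset (Site 2 × Fin 2 × Fin 3))

/-- The cylinder "`F` closed". -/
local notation "CylF" => (localCylinder (↑Fc : Set (Site 2 × Fin 2 × Fin 3)) (∅ : Set (Site 2 × Fin 2 × Fin 3)))

/-! ### The three own coins are distinct -/

/-- `|F₃| = 3`. -/
theorem card_F₃ (hd : d' ≠ d) : (F₃).card = 3 := by
  have h01 : (pt⟪0, 0⟫, d, (0 : Fin 3)) ≠ (pt⟪1, 0⟫, d, (0 : Fin 3)) := by
    simp only [Ne, Prod.mk.injEq, pt_eq_iff hd]; norm_num
  have h02 : (pt⟪0, 0⟫, d, (0 : Fin 3)) ≠ (pt⟪2, 0⟫, d, (0 : Fin 3)) := by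
    simp only [Ne, Prod.mk.injEq, pt_eq_iff hd]; norm_num
  have h12 : (pt⟪1, 0⟫, d, (0 : Fin 3)) ≠ (pt⟪2, 0⟫, d, (0 : Fin 3)) := by
    simp only [Ne, Prod.mk.injEq, pt_eq_iff hd]; norm_num
  rw [Finset.card_insert_of_notMem, Finset.card_insert_of_notMem, Finset.card_singleton]
  · rwa [Finset.mem_singleton]
  · rw [Finset.mem_insert, Finset.mem_singleton, not_or]; exact ⟨h01, h02⟩

/-- A proper pattern misses some own coin. -/
theorem exists_notMem_of_ne {pat : Finset (Site 2 × Fin 2 × Fin 3)} (hpat : pat ⊆ F₃) (hne : pat ≠ F₃) :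
    (pt⟪0, 0⟫, d, (0 : Fin 3)) ∉ pat ∨ (pt⟪1, 0⟫, d, (0 : Fin 3)) ∉ pat ∨ (pt⟪2, 0⟫, d, (0 : Fin 3)) ∉ pat := by
  by_contra h
  push Not at h
  apply hne
  refine Finset.Subset.antisymm hpat ?_
  intro i hi
  simp only [Finset.mem_insert, Finset.mem_singleton] at hi
  rcases hi with rfl | rfl | rfl
  · exact h.1
  · exact h.2.1
  · exact h.2.2

/-- `e_j ∈ T(pat)` iff `o_j ∈ pat`. -/
theorem mem_Tof_iff (hd : d' ≠ d) (X : Set (Site 2 × Fin 2 × Fin 3)) (j : ℤ) (hj : j = 0 ∨ j = 1 ∨ j = 2) :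
    (pt⟪j, 0⟫, d) ∈ Tof⟪X⟫ ↔ (pt⟪j, 0⟫, d, (0 : Fin 3)) ∈ X := by
  simp only [Set.mem_setOf_eq, Prod.mk.injEq, pt_eq_iff hd, and_true]
  rcases hj with rfl | rfl | rfl <;> simp

/-! ### On the two-sided event with `F` closed -/

/-- On `C₂ ∩ CylF` a proper pattern does not cross, and the full tuple does. -/
theorem C2_cylF_pattern (hd : d' ≠ d) (hbox : ∀ j : ℤ, 0 ≤ j → j ≤ 3 → pt⟪j, 0⟫ ∈ Bx)
    (hm1 : pt⟪1, 0⟫ ∉ Lx ∧ pt⟪1, 0⟫ ∉ Rx) (hm2 : pt⟪2, 0⟫ ∉ Lx ∧ pt⟪2, 0⟫ ∉ Rx) (huR : pt⟪0, 0⟫ ∉ Rx)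
    {S : Set (Site 2 × Fin 2 × Fin 3)} (hS : S ∈ C2) (hcyl : S ∈ CylF) {pat : Finset (Site 2 × Fin 2 × Fin 3)}
    (hmiss : (pt⟪0, 0⟫, d, (0 : Fin 3)) ∉ pat ∨ (pt⟪1, 0⟫, d, (0 : Fin 3)) ∉ pat ∨ (pt⟪2, 0⟫, d, (0 : Fin 3)) ∉ pat) :
    S ∈ Z⟪Tl, Tl⟫ ∧ S ∉ Z⟪Tl, Tof⟪(↑pat : Set (Site 2 × Fin 2 × Fin 3))⟫⟫ := by
  have hu := hbox 0 le_rfl (by norm_num)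
  have hw := hbox 3 (by norm_num) le_rfl
  have hV := op_diff_eq_of_cylF hd hcyl
  have hyes : Cr⟪(Op⟪S⟫ \ (Tl ∪ Fl)) ∪ Tl⟫ := hS.1
  have hno : ¬ Cr⟪Op⟪S⟫ \ (Tl ∪ Fl)⟫ := fun h => hS.2 (by
    show Cr⟪(Op⟪S⟫ \ (Tl ∪ Fl)) ∪ ∅⟫
    rw [Set.union_empty]; exact h)
  have hT : ∀ e ∈ Tl, e ∉ Op⟪S⟫ \ (Tl ∪ Fl) := fun e he h => h.2 (Or.inl he)
  have hF : ∀ e ∈ Fl, e ∉ Op⟪S⟫ \ (Tl ∪ Fl) := fun e he h => h.2 (Or.inr he)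
  have htwo := twoSided_of_crossing hd hT hF hu hw hm1 hm2 hno hyes
  constructor
  · show Cr⟪(Op⟪S⟫ \ Tl) ∪ Tl⟫
    rw [hV]; exact hyes
  · intro h
    have h' : Cr⟪(Op⟪S⟫ \ (Tl ∪ Fl)) ∪ Tof⟪(↑pat : Set (Site 2 × Fin 2 × Fin 3))⟫⟫ := by rw [← hV]; exact h
    refine not_crossing_of_twoSided hd hT hF hu hw hm1 hm2 huR hno htwo (Tof_subset _) ?_ h'
    rcases hmiss with hm | hm | hm
    · exact Or.inl (fun h'' => hm ((mem_Tof_iff hd _ 0 (Or.inl rfl)).1 h''))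
    · exact Or.inr (Or.inl (fun h'' => hm ((mem_Tof_iff hd _ 1 (Or.inr (Or.inl rfl))).1 h'')))
    · exact Or.inr (Or.inr (fun h'' => hm ((mem_Tof_iff hd _ 2 (Or.inr (Or.inr rfl))).1 h'')))

/-! ### Probabilities -/

/-- `P(CylF) ≥ (1 - c)^4 ≥ 6561/10000` for `c ≤ 1/10`. -/
theorem real_cylF_ge (hd : d' ≠ d) (hc0 : 0 ≤ c) (hc : c ≤ 1 / 10) : (6561 / 10000 : ℝ) ≤ (P).real CylF := by
  classical
  have hc1 : c ≤ 1 := by linarith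
  rw [real_localCylinder_eq]
  have h : ∏ i ∈ Fc, (if i ∈ (∅ : Set (Site 2 × Fin 2 × Fin 3)) then ((refinementParam 3 ρ c i : unitInterval) : ℝ)
      else 1 - ((refinementParam 3 ρ c i : unitInterval) : ℝ)) = ∏ i ∈ Fc, (1 - c) := by
    refine Finset.prod_congr rfl fun i hi => ?_
    rw [if_neg (Set.notMem_empty _)]
    obtain ⟨ℓ, hℓ, rfl⟩ := mem_Fc_iff.1 hi
    rw [coe_param_interior hc0 hc1 (not_axial_of_mem_Fl hd hℓ)]
  rw [h, Finset.prod_const]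
  calc (6561 / 10000 : ℝ) = (9 / 10) ^ 4 := by norm_num
    _ ≤ (9 / 10) ^ (Fc).card := pow_le_pow_of_le_one (by norm_num) (by norm_num) Finset.card_le_four
    _ ≤ (1 - c) ^ (Fc).card := pow_le_pow_left₀ (by norm_num) (by linarith) _

/-- `P(C₂ ∩ CylF) = P(CylF) · P(C₂)`. -/
theorem real_C2_inter_cylF (hd : d' ≠ d) : (P).real (C2 ∩ CylF) = (P).real CylF * (P).real C2 := by
  rw [Set.inter_comm]
  exact real_localCylinder_inter _ _ _ (determinedBy_C2 hd) measurableSet_C2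

/-! ### The pattern sums for small `c` -/

/-- **The pattern sums, `c ≤ 1/10`.** -/
theorem sum_patterns_le_smallC (hd : d' ≠ d) (hρ0 : 0 ≤ ρ) (hρ1 : ρ ≤ 1) (hc0 : 0 ≤ c) (hc : c ≤ 1 / 10)
    (hbox : ∀ j : ℤ, 0 ≤ j → j ≤ 3 → pt⟪j, 0⟫ ∈ Bx)
    (hm1 : pt⟪1, 0⟫ ∉ Lx ∧ pt⟪1, 0⟫ ∉ Rx) (hm2 : pt⟪2, 0⟫ ∉ Lx ∧ pt⟪2, 0⟫ ∉ Rx) (huR : pt⟪0, 0⟫ ∉ Rx) :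
    ∑ pat ∈ (F₃).powerset, (P).real (Z⟪Tl, Tof⟪(↑pat : Set (Site 2 × Fin 2 × Fin 3))⟫⟫ \
        Z⟪Tl, (∅ : Set (Site 2 × Fin 2))⟫) ≤
      ∑ pat ∈ (F₃).powerset, (P).real (Z⟪Tl, Tl⟫ \ Z⟪Tl, Tof⟪(↑pat : Set (Site 2 × Fin 2 × Fin 3))⟫⟫) +
        6656 * ∑ g' ∈ Πf, (P).real Piv⟪g'⟫ := by
  classical
  set PS := ∑ g' ∈ Πf, (P).real Piv⟪g'⟫ with hPS
  have hPS0 : 0 ≤ PS := Finset.sum_nonneg fun _ _ => measureReal_nonneg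
  set X := (P).real (C2 ∩ CylF) with hX
  set Y := (P).real (C2 \ CylF) with hY
  set CH := (P).real ((Z⟪Tl, Tl⟫ \ Z⟪Tl, (∅ : Set (Site 2 × Fin 2))⟫) \ C2) with hCH
  have hX0 : 0 ≤ X := measureReal_nonneg
  have hY0 : 0 ≤ Y := measureReal_nonneg
  have hcylm : MeasurableSet CylF := measurableSet_localCylinder (Fc).finite_toSet.countable _
  have hC2m : MeasurableSet C2 := measurableSet_C2
  -- the key numerical facts
  have hCH : CH ≤ 832 * PS := real_pivotal_diff_C2_le hd hρ0 hρ1 hc0 hc hbox hm1 hm2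
  have hq : (6561 / 10000 : ℝ) ≤ (P).real CylF := real_cylF_ge (ρ := ρ) hd hc0 hc
  have hXY : X + Y = (P).real C2 := measureReal_inter_add_sdiff hcylm
  have hXq : X = (P).real CylF * (P).real C2 := real_C2_inter_cylF hd
  have hp0 : 0 ≤ (P).real C2 := measureReal_nonneg
  have hineq : X + 8 * Y ≤ 7 * X := by
    have h1 : (6561 / 10000 : ℝ) * (P).real C2 ≤ X := by
      rw [hXq]; exact mul_le_mul_of_nonneg_right hq hp0
    nlinarith
  -- upper bound for each left term
  have hleft : ∀ pat ∈ (F₃).powerset,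
      (P).real (Z⟪Tl, Tof⟪(↑pat : Set (Site 2 × Fin 2 × Fin 3))⟫⟫ \ Z⟪Tl, (∅ : Set (Site 2 × Fin 2))⟫) ≤
        CH + ((if pat = F₃ then X else 0) + Y) := by
    intro pat hpat
    set A := Z⟪Tl, Tof⟪(↑pat : Set (Site 2 × Fin 2 × Fin 3))⟫⟫ \ Z⟪Tl, (∅ : Set (Site 2 × Fin 2))⟫ with hA
    have hsplit : (P).real (A ∩ C2) + (P).real (A \ C2) = (P).real A := measureReal_inter_add_sdiff hC2m
    have hsplit2 : (P).real (A ∩ C2 ∩ CylF) + (P).real ((A ∩ C2) \ CylF) = (P).real (A ∩ C2) :=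
      measureReal_inter_add_sdiff hcylm
    have h1 : (P).real (A \ C2) ≤ CH := by
      refine measureReal_mono (fun S hS => ⟨⟨?_, hS.1.2⟩, hS.2⟩) (measure_ne_top _ _)
      exact crossing_mono (Set.union_subset_union_right _ (Tof_subset _)) hS.1.1
    have h2 : (P).real ((A ∩ C2) \ CylF) ≤ Y :=
      measureReal_mono (fun S hS => ⟨hS.1.2, hS.2⟩) (measure_ne_top _ _)
    have h3 : (P).real (A ∩ C2 ∩ CylF) ≤ if pat = F₃ then X else 0 := by
      split_ifs with hpF
      · exact measureReal_mono (fun S hS => ⟨hS.1.2, hS.2⟩) (measure_ne_top _ _)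
      · have hempty : A ∩ C2 ∩ CylF = ∅ := Set.subset_empty_iff.1 fun S hS =>
          (C2_cylF_pattern hd hbox hm1 hm2 huR hS.1.2 hS.2
            (exists_notMem_of_ne (Finset.mem_powerset.1 hpat) hpF)).2 hS.1.1.1
        rw [hempty, measureReal_empty]
    linarith
  -- lower bound for each right term
  have hright : ∀ pat ∈ (F₃).powerset,
      (if pat = F₃ then 0 else X) ≤ (P).real (Z⟪Tl, Tl⟫ \ Z⟪Tl, Tof⟪(↑pat : Set (Site 2 × Fin 2 × Fin 3))⟫⟫) := by
    intro pat hpat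
    split_ifs with hpF
    · exact measureReal_nonneg
    · refine measureReal_mono (fun S hS => ?_) (measure_ne_top _ _)
      exact C2_cylF_pattern hd hbox hm1 hm2 huR hS.1 hS.2 (exists_notMem_of_ne (Finset.mem_powerset.1 hpat) hpF)
  -- summing
  have hcardp : ((F₃).powerset.card : ℝ) = 8 := by
    rw [Finset.card_powerset, card_F₃ hd]; norm_num
  have hF₃mem : F₃ ∈ (F₃).powerset := Finset.mem_powerset.2 Finset.Subset.rfl
  have hsumL := Finset.sum_le_sum hleft
  rw [Finset.sum_add_distrib, Finset.sum_add_distrib, Finset.sum_const, Finset.sum_const, nsmul_eq_mul,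
    nsmul_eq_mul, hcardp, Finset.sum_ite_eq' _ _ (fun _ => X), if_pos hF₃mem] at hsumL
  have hsumR := Finset.sum_le_sum hright
  have hiteR : ∑ pat ∈ (F₃).powerset, (if pat = F₃ then (0 : ℝ) else X) = 8 * X - X := by
    have : ∀ pat ∈ (F₃).powerset, (if pat = F₃ then (0 : ℝ) else X) = X - (if pat = F₃ then X else 0) := by
      intro pat _; split_ifs <;> ring
    rw [Finset.sum_congr rfl this, Finset.sum_sub_distrib, Finset.sum_const, nsmul_eq_mul, hcardp,
      Finset.sum_ite_eq' _ _ (fun _ => X), if_pos hF₃mem]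
  rw [hiteR] at hsumR
  linarith

end Cone3

/-- **Registered sub-goal `stub_cone3_smallB` of stub `stub_cone3`** (`Cone3.real_cylF_ge` with all local notations
expanded). -/
theorem stub_cone3_smallB : ∀ {ρ c : ℝ} {b : Site 2} {d d' : Fin 2} (hd : d' ≠ d) (hc0 : 0 ≤ c) (hc : c ≤ 1 / 10), (6561 / 10000 : ℝ) ≤ (((prodBernoulli (refinementParam 3 ρ c)))).real ((localCylinder (↑(({((((3 : ℤ) • b + ((1) : ℤ) • (Pi.single d (1 : ℤ) : Site 2) + ((0) : ℤ) • (Pi.single d' (1 : ℤ) : Site 2))), d', (0 : Fin 3)), ((((3 : ℤ) • b + ((1) : ℤ) • (Pi.single d (1 : ℤ) : Site 2) + ((-1) : ℤ) • (Pi.single d' (1 : ℤ) : Site 2))), d', (0 : Fin 3)), ((((3 : ℤ) • b + ((2) : ℤ) • (Pi.single d (1 : ℤ) : Site 2) + ((0) : ℤ) • (Pi.single d' (1 : ℤ) : Site 2))), d', (0 : Fin 3)), ((((3 : ℤ) • b + ((2) : ℤ) • (Pi.single d (1 : ℤ) : Site 2) + ((-1) : ℤ) • (Pi.single d' (1 :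 ℤ) : Site 2))), d', (0 : Fin 3))} : Finset (Site 2 × Fin 2 × Fin 3))) : Set (Site 2 × Fin 2 × Fin 3)) (∅ : Set (Site 2 × Fin 2 × Fin 3)))) := by
  intro ρ c b d d' hd hc0 hc
  exact Cone3.real_cylF_ge hd hc0 hc

end Summit.CriticalPhenomena.CardyFormulaZ2.Cruxes.CriticalPathRSW.FiniteSizeEnvelope

end
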